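import Literature.NumberTheory.Automorphic.UnitaryThreeFixedPointsCount                 -- ★ (F3c-C9-inst) B-p04: Cor. 9 counted in the Flicker frame
import Literature.NumberTheory.Automorphic.UnitaryThreeTorusDoubleCosetsHK               -- ★ (F3c-γ) B-p12: Prop. 6 (a) `hA`
import Literature.NumberTheory.Automorphic.UnitaryThreeTorusDoubleCosetsHKDisjoint       -- ★ (F3c-γ) B-p12: Prop. 6 (b) `hB`
import Literature.NumberTheory.Automorphic.UnitaryThreeTorusDoubleCosetsHKWeight         -- ★ (F3c-γ) B-p12: Prop. 6 (c) the weight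
import HarnessLib

/-!
# Flicker's Cor. 9 ASSEMBLED at the θ-torus: `#{x ∈ H ⧸ H^K_m : t_θ·x = x} = Σᶠᵢ w(2i+ε) · #{y ∈ P_H ⧸ (P_H ∩ H^K_m) : ỹ⁻¹ (rᵢ⁻¹ t_θ rᵢ) ỹ ∈ H^K_m}`, `w(0) = 1`,
# `w(j) = (q₀+1)·q₀^{j−1}` (Flicker 1998, Cor. 9 p. 85, with Prop. 6 p. 83 and Prop. 8 p. 84)

Topic `NumberTheory/Automorphic`; namespace `Literature.NumberTheory.Automorphic.UnitaryGroup`.  ONE THEOREM (no `def`, no instance, no notation, no named fact, no `sorry`;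
one `synthInstance.maxHeartbeats` bump for the `MulAction` instance on `↥H ⧸ M`).  Cell `pub/hodgecm-mathlib`, F0∕P3a road «N7-ns COUNT FROM FLICKER» (MAP v3, architect
A-p06 (g26)), brick **(F3c-C9-θ)** (B-p04 (g33), 06:00Z, B-p12 (g28)'s offer (i) taken by its natural owner): ★ (F3c-C9-inst) `natCard_fixedPoints_centralizer_eq_finsum`
(p841447) with `hA` ∕ `hB` ∕ the weight DISCHARGED by ★ B-p12's Prop. 6 (a) `exists_mem_centralizer_mul_diagRadial_mul_mem_flickerKH` (p841445), (b)
`eq_of_centralizer_mul_diagRadial_mul_flickerKH_eq` (p841471), (c) `relIndex_flickerKH_conj_diagRadial_eq` (p841623) — in their binder alphabet VERBATIM (abstract bridge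
`(R, ι, σR, dR, ϖR, q₀)` instantiated by the assembler at `R := 𝒪[K]`, `ι := subtype`; torus `θ = ϖ^ε`, `ε ≤ 1`, `t = !![A,0,B;0,b₀,0;C,0,A]`, `C ≠ 0`, `Bθ′ = Cθ`;
`r i = diag(ϖ^{−i},1,ϖ^{i})` from ★ `exists_diagRadial`).  What remains hypothetical: ONLY the finiteness `hfin` of the fixed-point set (the assembler's compactness).
DOWNSTREAM: re-index `j = 2i + ε` by ★ A-p03 `finsum_comp_two_mul_add_eq_finsum_ite` (p841612); inner counts = ★ `natCard_cosets_flickerTorus_eq_iTen` (`1 ≤ j ≤ N`) ∕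
★ `…_eq_zero_of_lt` (`j > N`) ∕ Prop. 13 (`j = 0`, ★ p841516 + companions), so Cor. 9 becomes F0P3b-p01's `Σᶠ j, if j % 2 = θ̄ then corNineWeight q j · I j m else 0`.
HC_CM is proved only modulo the printed citations until rung 0 closes; structure theory for ONE clause of #103-ns, pays nothing by itself.

* **`natCard_fixedPoints_flickerTorus_eq_finsum (hJ hd hy m hum) (ι hι hιv σR hσR hσι hdRσ hdRu h2R hϖR hιϖ hq) (hc) (hε hθε hθ) (htH hte hC hBC) (r hr) (hfin) :
  Nat.card {x : ↥H ⧸ (flickerHK σ J c um).subgroupOf H // ⟨t,htH⟩ • x = x} = ∑ᶠ i, (if 2i+ε = 0 then 1 else (q₀+1) q₀^(2i+ε−1)) · Nat.card {w : ↥P_H ⧸ … // (out w)⁻¹ ↑((r i)⁻¹ ⟨t,htH⟩ (r i)) (out w) ∈ flickerHK σ J c um}`**.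

## References
* [Flicker1998UnitaryFL] Y. Z. Flicker, *Elementary proof of the fundamental lemma for a unitary group*, Canad. J. Math. 50 (1998), Prop. 6 p. 83, Prop. 8 p. 84, Cor. 9 p. 85.
-/

open scoped MatrixGroups WithZero
open Matrix

namespace Literature.NumberTheory.Automorphic

namespace UnitaryGroup

open Literature.NumberTheory.Automorphic.HermitianLattice (unitaryInt mem_unitaryInt_iff LocalConjDatum)
open IsLocalRing

universe u

section Theta

variable {K : Type*} [Field K] [Valued K ℤᵐ⁰] {ϖ : K} (σ : K →+* K) {J : Matrix (Fin 3) (Fin 3) K}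

set_option synthInstance.maxHeartbeats 120000 in
/-- **FLICKER'S COR. 9 AT THE θ-TORUS, ASSEMBLED** (type (1), `θ = ϖ^ε`, `ε ∈ {0,1}`): for the regular block `t = !![A,0,B;0,b₀,0;C,0,A] ∈ H` (`C ≠ 0`, `Bθ′ = Cθ`),
`T = Z_H(t)`, the radial representatives `rᵢ = diag(ϖ^{−i}, 1, ϖ^{i})`, and finitely many fixed points,
`#{x ∈ H ⧸ H^K_m : t·x = x} = Σᶠᵢ w(2i+ε) · #{w ∈ P_H ⧸ (P_H ∩ H^K_m) : w̃⁻¹ (rᵢ⁻¹ t rᵢ) w̃ ∈ H^K_m}` with `w(0) = 1`, `w(j) = (q₀+1)q₀^{j−1}` — ★ (F3c-C9-inst)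
`natCard_fixedPoints_centralizer_eq_finsum` with `hA` ∕ `hB` ∕ the weight DISCHARGED by ★ B-p12 (g28)'s Prop. 6 (a)(b)(c) (p841445 ∕ p841471 ∕ p841623), in their binder
alphabet verbatim (abstract bridge `(R, ι, σR)` instantiated by the assembler at `R := 𝒪[K]`).  Re-index `j = 2i + ε` with ★ A-p03 `finsum_comp_two_mul_add_eq_finsum_ite`;
the inner counts are ★ `natCard_cosets_flickerTorus_eq_iTen` (`1 ≤ j ≤ N`), ★ `…_eq_zero_of_lt` (`j > N`), Prop. 13 (`j = 0`).
[cite: Flicker1998UnitaryFL, Cor. 9 p. 85; Prop. 6 p. 83; Prop. 8 p. 84] -/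
theorem natCard_fixedPoints_flickerTorus_eq_finsum (hJ : J = (StdForm.antidiagonal 3).over K) (hd : LocalConjDatum σ ϖ) {y : K}
    (hy : y * σ y = -2) (m : ℕ) {um : ↥(unitaryGroupOfForm σ J)}
    (hum : ((um : GL (Fin 3) K) : Matrix (Fin 3) (Fin 3) K) = !![ϖ ^ m, y, (ϖ ^ m)⁻¹; 0, 1, -σ y * (ϖ ^ m)⁻¹; 0, 0, (ϖ ^ m)⁻¹])
    {R : Type u} [CommRing R] [IsDomain R] [IsDiscreteValuationRing R] [Finite (ResidueField R)] (ι : R →+* K) (hι : Function.Injective ι)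
    (hιv : ∀ x : K, Valued.v x ≤ 1 ↔ x ∈ Set.range ι) (σR : R →+* R) (hσR : ∀ r, σR (σR r) = r) (hσι : ∀ r, ι (σR r) = σ (ι r))
    {dR : R} (hdRσ : σR dR = -dR) (hdRu : IsUnit dR) (h2R : IsUnit (2 : R)) {ϖR : R} (hϖR : Irreducible ϖR) (hιϖ : ι ϖR = ϖ)
    {q₀ : ℕ} (hq : Nat.card (ResidueField R) = q₀ ^ 2)
    {c : ↥(unitaryGroupOfForm σ J)} (hc : ((c : GL (Fin 3) K) : Matrix (Fin 3) (Fin 3) K) = !![1, 0, 0; 0, -1, 0; 0, 0, 1])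
    {θ θ' : K} {ε : ℕ} (hε : ε ≤ 1) (hθε : θ = ϖ ^ ε) (hθ : θ * θ' = 1)
    {t : ↥(unitaryGroupOfForm σ J)} (htH : t ∈ Subgroup.centralizer ({c} : Set ↥(unitaryGroupOfForm σ J))) {A B C b₀ : K}
    (hte : ((t : GL (Fin 3) K) : Matrix (Fin 3) (Fin 3) K) = !![A, 0, B; 0, b₀, 0; C, 0, A]) (hC : C ≠ 0) (hBC : B * θ' = C * θ)
    (r : ℕ → ↥(Subgroup.centralizer ({c} : Set ↥(unitaryGroupOfForm σ J))))
    (hr : ∀ i, (((r i : ↥(unitaryGroupOfForm σ J)) : GL (Fin 3) K) : Matrix (Fin 3) (Fin 3) K) = !![(ϖ ^ i)⁻¹, 0, 0; 0, 1, 0; 0, 0, ϖ ^ i])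
    (hfin : {x : ↥(Subgroup.centralizer ({c} : Set ↥(unitaryGroupOfForm σ J))) ⧸
        (flickerHK σ J c um).subgroupOf (Subgroup.centralizer ({c} : Set ↥(unitaryGroupOfForm σ J))) |
      (⟨t, htH⟩ : ↥(Subgroup.centralizer ({c} : Set ↥(unitaryGroupOfForm σ J)))) • x = x}.Finite) :
    Nat.card {x : ↥(Subgroup.centralizer ({c} : Set ↥(unitaryGroupOfForm σ J))) ⧸
        (flickerHK σ J c um).subgroupOf (Subgroup.centralizer ({c} : Set ↥(unitaryGroupOfForm σ J))) //
        (⟨t, htH⟩ : ↥(Subgroup.centralizer ({c} : Set ↥(unitaryGroupOfForm σ J)))) • x = x} =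
      ∑ᶠ i : ℕ, (if 2 * i + ε = 0 then 1 else (q₀ + 1) * q₀ ^ (2 * i + ε - 1)) *
        Nat.card {w : ↥(flickerPH σ J c) ⧸ (flickerHK σ J c um).subgroupOf (flickerPH σ J c) //
          ((Quotient.out w : ↥(flickerPH σ J c)) : ↥(unitaryGroupOfForm σ J))⁻¹ *
              (((r i)⁻¹ * ⟨t, htH⟩ * r i : ↥(Subgroup.centralizer ({c} : Set ↥(unitaryGroupOfForm σ J)))) : ↥(unitaryGroupOfForm σ J)) *
            (Quotient.out w : ↥(flickerPH σ J c)) ∈ flickerHK σ J c um} := by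
  have ht' : ∀ τ ∈ Subgroup.centralizer ({⟨t, htH⟩} : Set ↥(Subgroup.centralizer ({c} : Set ↥(unitaryGroupOfForm σ J)))),
      τ * ⟨t, htH⟩ = ⟨t, htH⟩ * τ := fun τ hτ => Subgroup.mem_centralizer_singleton_iff.1 hτ
  rw [natCard_fixedPoints_centralizer_eq_finsum σ hJ hd hy m hum hc r ⟨t, htH⟩ _ ht'
    (exists_mem_centralizer_mul_diagRadial_mul_mem_flickerKH σ hJ hd ι hι hιv σR hσR hσι hdRσ hdRu h2R hϖR hιϖ hc hε hθε hθ htH hte hC hBC r hr)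
    (eq_of_centralizer_mul_diagRadial_mul_flickerKH_eq σ hJ hd hc hθε hθ htH hte hC hBC r hr) hfin]
  refine finsum_congr fun i => ?_
  rw [relIndex_flickerKH_conj_diagRadial_eq σ hJ hd ι hι hιv σR hσR hσι hdRσ hdRu h2R hϖR hιϖ hq hc hθε hθ htH hte hC hBC r hr i]

end Theta

end UnitaryGroup

end Literature.NumberTheory.Automorphic
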